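import Summits.QuantumFields.YangMills.Theorems.UnitScaleTiltHistoryTailBoundedHeightLocal
import Summits.QuantumFields.YangMills.Theorems.CovariantDischargeDirectionNet
import Literature.MathematicalPhysics.QuantumFieldTheory.Balaban1983to89.T3InteriorExcision
import HarnessLib

/-!
# Line «revelation_martingale» on crux `HistoryTailL` (stmt-QuantumFields-19936) — its stub `stub_meanDeviation` (= crux `MeanDeviationL`,
# stmt-QuantumFields-23083) AT BOUNDED DEPTH: `E dist1(Ū^j(∂p)) ≤ ½θ(b₀)(K−j)` for `1 ≤ j ≤ j₀`, every `K ≥ j`, once `γ ≤ γ₁(L, j₀, b₀, p₀)`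

Cell `ym3-torus` (YM ladder rung R3 = continuum SU(2) Yang–Mills on the three-torus — a RUNG, NOT the Clay problem: not d = 4, not infinite
volume, not a mass gap), width seat `ym-ust-19936-w3` gen 8.  The registered line «revelation_martingale»
(`Cruxes/HistoryTailL/Lines/revelation_martingale.lean`, route `RevelationMartingale`) carries the centring stub `stub_meanDeviation :
Theses.RevelationMartingale.MeanDeviationL` — the K-UNIFORM first-moment bound `∫ dist1(Ū^j(∂p)) d(gibbsK K) ≤ ½θ(b₀)(K−j)` for ALL depths
`1 ≤ j ≤ K`.  THIS FILE proves its BOUNDED-DEPTH part with the threshold chosen before the family: for every `L, j₀, b₀ > 0, p₀ > 2` there is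
`γ₁ ∈ (0, 1]` such that the bound holds for every family `F` (`F.L = L`), every `0 < γ ≤ γ₁`, every `1 ≤ j ≤ j₀`, `j ≤ K`, every plaquette —
from the volume-uniform bounded-height tail of the tree (`HistoryTailBoundedHeightLocal.perPlaquette_boundedHeight_uniform`, ✓p652822:
`Gibbs_K{θ ≤ dist1} ≤ C·β_{K−j}⁵·e^{−c·p(g_{K−j})²}` with `C, c` depending on `L, j₀` only) by the layer-cake step `E f ≤ a + 2·μ{a ≤ f}`
(`0 ≤ dist1 ≤ 2` on `SU(2)`) at `a = θ(b₀/4) = θ/4` and the decay `C·g⁻¹⁰·e^{−c·p(g)²/16} ≤ g·p(g)/8` for `g ≤ g_*` (`p(g)² ≥ b₀²(1 + log g⁻¹)²`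
beats every power).

* §1 `integral_le_add_mul_measureReal_ge` — `∫ f dμ ≤ a + B·μ{a ≤ f}` for `0 ≤ f ≤ B`, finite `μ`, ANY `f` (no measurability: a measurable hull
  of the tail event is used).
* §2 `exists_exp_neg_mul_pFun_sq_le_pow` — for `c, b₀ > 0`, `p₀ ≥ 1` and `N : ℕ` there is `g_* ∈ (0,1]` with `e^{−c·p(b₀,p₀;g)²} ≤ g^N` on `(0, g_*]`.
* §3 ★`meanDeviation_boundedDepth` — the statement above: the text of `MeanDeviationL` with the extra binder `j ≤ j₀` and `γ₁` depending on `j₀`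
  (threshold linearity `θ(c·b₀) = c·θ(b₀)` is lit `T3InteriorExcision.θBal_mul`).

WHAT THIS IS NOT.  Bounded depth only: the constants of ✓p652822 blow up like `(81L³)^{j₀}`, `(151L²)^{2j₀}`, so `γ₁ → 0` as `j₀ → ∞`; the crux
`MeanDeviationL` (all depths `j ≤ K` with ONE `γ₁` — at `j = K` the unit-lattice smallness of the averaged field, i.e. the small-field output of
the renormalisation group) is NOT proved, nor `stub_levelOneRevelation`/`stub_higherRevelation`, the crux `HistoryTailL`, the rung R3, d = 4,
a continuum limit or a mass gap.  YM₃ on T³ is rung R3, NOT the Clay problem.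

References: T. Bałaban, CMP **102** (1985) 255–275 [Balaban1985UV3] ((7) p.257 thresholds; (71) p.273); CMP **98** (1985) 17–51
[Balaban1985Averaging] (Prop. 1 (51) p.26, behind ✓p652822).
-/

noncomputable section

open MeasureTheory
open Literature.MathematicalPhysics.QuantumFieldTheory.Balaban1983to89
open Literature.MathematicalPhysics.QuantumFieldTheory.Balaban1983to89.T3ContinuumYM3Torus
open Literature.MathematicalPhysics.QuantumFieldTheory.Balaban1983to89.T3UnitScaleTilt
open Literature.MathematicalPhysics.QuantumFieldTheory.Balaban1983to89.T3UnitLawDensityEML (ℰp)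
open Literature.MathematicalPhysics.QuantumFieldTheory.Balaban1983to89.T3MinimiserStabilityReduction (θBal_pos)
open Literature.MathematicalPhysics.QuantumFieldTheory.Balaban1983to89.B10LargeField (xlog pFun_eq one_le_xlog)
open Summit.QuantumFields.YangMills.Theorems.HistoryTailBoundedHeightLocal (perPlaquette_boundedHeight_uniform)
open Summit.QuantumFields.YangMills.Theorems.CovariantDischargeDirectionNet (dist1_le_two)

namespace Summit.QuantumFields.YangMills.Theorems.RevelationMartingaleMeanDeviationBoundedDepth

/-! ## §1 The layer-cake step for a bounded non-negative function -/

section LayerCake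

variable {X : Type*} [MeasurableSpace X] {μ : Measure X} [IsFiniteMeasure μ]

/-- **`∫ f dμ ≤ a + B·μ{a ≤ f}`** for `0 ≤ f ≤ B` pointwise, `0 ≤ a`, on a finite measure space — for ANY `f` (if `f` is not integrable the
left side is the junk value `0`; the tail event is replaced by its measurable hull). [folklore] -/
theorem integral_le_add_mul_measureReal_ge {f : X → ℝ} {a B : ℝ} (ha : 0 ≤ a) (hB : 0 ≤ B) (hf0 : ∀ x, 0 ≤ f x)
    (hfB : ∀ x, f x ≤ B) : ∫ x, f x ∂μ ≤ a * μ.real Set.univ + B * μ.real {x | a ≤ f x} := by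
  set S : Set X := toMeasurable μ {x | a ≤ f x} with hS_def
  have hSm : MeasurableSet S := measurableSet_toMeasurable μ _
  have hsub : {x | a ≤ f x} ⊆ S := subset_toMeasurable μ _
  have hμS : μ.real S = μ.real {x | a ≤ f x} := by
    rw [measureReal_def, measureReal_def, hS_def, measure_toMeasurable]
  have hg : Integrable (fun x => a + B * S.indicator (fun _ => (1 : ℝ)) x) μ :=
    (integrable_const a).add (((integrable_const (1 : ℝ)).indicator hSm).const_mul B)
  have hle : (fun x => f x) ≤ᵐ[μ] fun x => a + B * S.indicator (fun _ => (1 : ℝ)) x := by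
    refine ae_of_all _ fun x => ?_
    by_cases hx : a ≤ f x
    · have hxS : x ∈ S := hsub hx
      simp only [Set.indicator_of_mem hxS, mul_one]
      linarith [hfB x]
    · have h0 : 0 ≤ B * S.indicator (fun _ => (1 : ℝ)) x :=
        mul_nonneg hB (Set.indicator_nonneg (fun _ _ => zero_le_one) x)
      linarith [not_le.mp hx]
  calc ∫ x, f x ∂μ ≤ ∫ x, a + B * S.indicator (fun _ => (1 : ℝ)) x ∂μ :=
        integral_mono_of_nonneg (ae_of_all _ hf0) hg hle
    _ = a * μ.real Set.univ + B * μ.real {x | a ≤ f x} := by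
        rw [integral_add (integrable_const a) (((integrable_const (1 : ℝ)).indicator hSm).const_mul B), integral_const,
          integral_const_mul, integral_indicator_const (1 : ℝ) hSm, hμS, smul_eq_mul, smul_eq_mul]
        ring

/-- The same on a probability space: `∫ f dμ ≤ a + B·μ{a ≤ f}`. [folklore] -/
theorem integral_le_add_mul_measureReal_ge' [IsProbabilityMeasure μ] {f : X → ℝ} {a B : ℝ} (ha : 0 ≤ a) (hB : 0 ≤ B)
    (hf0 : ∀ x, 0 ≤ f x) (hfB : ∀ x, f x ≤ B) : ∫ x, f x ∂μ ≤ a + B * μ.real {x | a ≤ f x} := by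
  have h := integral_le_add_mul_measureReal_ge (μ := μ) ha hB hf0 hfB
  rwa [probReal_univ, mul_one] at h

end LayerCake

/-! ## §2 `e^{−c·p(g)²}` beats every power of `g` -/

section Decay

/-- **`e^{−c·p(b₀,p₀;g)²} ≤ g^N` for `g` small**: for `c, b₀ > 0`, `p₀ ≥ 1`, `N : ℕ` there is `g_* ∈ (0, 1]` with the bound on `(0, g_*]`
(`p(g) = b₀·x^{p₀} ≥ b₀·x`, `x = 1 + log g⁻¹ ≥ 1`, `g^N = e^{−N(x−1)}`, and `c·b₀²·x² ≥ N·(x − 1)` once `x ≥ N/(c·b₀²)`). [cite: Balaban1985UV3, (7) p.257] -/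
theorem exists_exp_neg_mul_pFun_sq_le_pow {c b₀ p₀ : ℝ} (hc : 0 < c) (hb₀ : 0 < b₀) (hp₀ : 1 ≤ p₀) (N : ℕ) :
    ∃ gs : ℝ, 0 < gs ∧ gs ≤ 1 ∧ ∀ g : ℝ, 0 < g → g ≤ gs → Real.exp (-(c * B10.pFun b₀ p₀ g ^ 2)) ≤ g ^ N := by
  set x₀ : ℝ := max 1 ((N : ℝ) / (c * b₀ ^ 2)) with hx₀_def
  have hx₀1 : 1 ≤ x₀ := le_max_left _ _
  refine ⟨Real.exp (1 - x₀), Real.exp_pos _, by rw [Real.exp_le_one_iff]; linarith, fun g hg hgle => ?_⟩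
  have hg1 : g ≤ 1 := hgle.trans (by rw [Real.exp_le_one_iff]; linarith)
  set x : ℝ := xlog g with hx_def
  have hx1 : 1 ≤ x := one_le_xlog hg hg1
  -- `x ≥ x₀` from `g ≤ e^{1 − x₀}`
  have hxx₀ : x₀ ≤ x := by
    have h1 : Real.log g ≤ 1 - x₀ := by
      have := Real.log_le_log hg hgle
      rwa [Real.log_exp] at this
    have h2 : x = 1 - Real.log g := by rw [hx_def, xlog, Real.log_inv]; ring
    linarith
  -- `p(g) ≥ b₀·x`
  have hp : b₀ * x ≤ B10.pFun b₀ p₀ g := by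
    rw [pFun_eq]
    refine mul_le_mul_of_nonneg_left ?_ hb₀.le
    calc x = x ^ (1 : ℝ) := (Real.rpow_one x).symm
      _ ≤ x ^ p₀ := Real.rpow_le_rpow_of_exponent_le hx1 hp₀
  have hp0 : 0 ≤ b₀ * x := mul_nonneg hb₀.le (zero_le_one.trans hx1)
  have hp2 : (b₀ * x) ^ 2 ≤ B10.pFun b₀ p₀ g ^ 2 := pow_le_pow_left₀ hp0 hp 2
  -- `g^N = e^{−N(x−1)}`
  have hgN : g ^ N = Real.exp (-((N : ℝ) * (x - 1))) := by
    have hx' : x - 1 = -Real.log g := by rw [hx_def, xlog, Real.log_inv]; ring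
    rw [hx', mul_neg, neg_neg, Real.exp_nat_mul, Real.exp_log hg]
  rw [hgN, Real.exp_le_exp, neg_le_neg_iff]
  -- `N(x−1) ≤ c b₀² x₀ x ≤ c b₀² x² ≤ c p²`
  have hcb : 0 < c * b₀ ^ 2 := by positivity
  have hNx₀ : (N : ℝ) ≤ c * b₀ ^ 2 * x₀ := by
    have : (N : ℝ) / (c * b₀ ^ 2) ≤ x₀ := le_max_right _ _
    rwa [div_le_iff₀ hcb, mul_comm] at this
  calc (N : ℝ) * (x - 1) ≤ (N : ℝ) * x := by nlinarith [Nat.cast_nonneg (α := ℝ) N]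
    _ ≤ c * b₀ ^ 2 * x₀ * x := mul_le_mul_of_nonneg_right hNx₀ (zero_le_one.trans hx1)
    _ = (c * b₀ ^ 2 * x) * x₀ := by ring
    _ ≤ (c * b₀ ^ 2 * x) * x := mul_le_mul_of_nonneg_left hxx₀ (by positivity)
    _ = c * (b₀ * x) ^ 2 := by ring
    _ ≤ c * B10.pFun b₀ p₀ g ^ 2 := mul_le_mul_of_nonneg_left hp2 hc.le

end Decay

/-! ## §3 `MeanDeviationL` at bounded depth -/

section Mean

/-- **`MeanDeviationL` AT BOUNDED DEPTH.**  For every `L, j₀` and profile `b₀ > 0`, `p₀ > 2` there is `γ₁ ∈ (0, 1]` such that for every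
family `F` with `F.L = L`, every `0 < γ ≤ γ₁`, every depth `1 ≤ j ≤ j₀` with `j ≤ K` and every plaquette `p` of `T^{(j)}`:
`∫ dist1(Ū^j(∂p)) d(gibbsK K) ≤ ½·θ(b₀)(K−j)`.  Layer cake at `a = θ/4` + the volume-uniform bounded-height tail ✓p652822 at the profile
`b₀/4` + the decay lemma of §2 (`N = 12`, the polynomial loss is `β⁵ = g⁻¹⁰`). [cite: Balaban1985UV3, (7) p.257 and (71) p.273] -/
theorem meanDeviation_boundedDepth (L j₀ : ℕ) {b₀ p₀ : ℝ} (hb₀ : 0 < b₀) (hp₀ : 2 < p₀) :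
    ∃ γ₁ : ℝ, 0 < γ₁ ∧ γ₁ ≤ 1 ∧ ∀ (F : T3Family) (γ : ℝ), F.L = L → 0 < γ → γ ≤ γ₁ → ∀ (K j : ℕ), 1 ≤ j → j ≤ K → j ≤ j₀ →
      ∀ p : Plaq (F.P K) j,
        ∫ U, GaugeGroup.dist1 (GaugeField.plaqHol (Averaging.iter (fun i => BlockAveraging.blockAvg (P := F.P K) (j := i) ℰp) j U) p)
            ∂(gibbsK F ℰp γ K) ≤ θBal F.L γ b₀ p₀ (K - j) / 2 := by
  obtain ⟨C, c, hC, hc, htail⟩ := perPlaquette_boundedHeight_uniform L j₀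
  -- decay at the profile `b₀/4`: `e^{−c·p(b₀/4; g)²} ≤ g^{12}`
  obtain ⟨gs, hgs, hgs1, hdec⟩ :=
    exists_exp_neg_mul_pFun_sq_le_pow (c := c) (b₀ := b₀ / 4) (p₀ := p₀) hc (by positivity) (by linarith) 12
  -- the coupling threshold: `g ≤ gs` and `g ≤ b₀/(16(C+1))`
  set g₁ : ℝ := min gs (b₀ / (16 * (C + 1))) with hg₁_def
  have hg₁ : 0 < g₁ := lt_min hgs (by positivity)
  refine ⟨min 1 (g₁ ^ 2), lt_min one_pos (pow_pos hg₁ 2), min_le_left _ _, ?_⟩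
  intro F γ hFL hγ hγ1 K j hj1 hjK hj0 p
  have hγone : γ ≤ 1 := hγ1.trans (min_le_left _ _)
  have hL1 : 1 ≤ F.L := F.hL.2.le
  have hLpos : (0 : ℝ) < F.L := by exact_mod_cast (zero_lt_one.trans_le hL1)
  haveI := isProbabilityMeasure_gibbsK F ℰp hγ.le K
  -- the coupling `g = g_{K−j} = √(γ L^{−(K−j)})`
  have hq0 : 0 < γ * ((F.L : ℝ)⁻¹) ^ (K - j) := mul_pos hγ (pow_pos (inv_pos.mpr hLpos) _)
  have hq1 : γ * ((F.L : ℝ)⁻¹) ^ (K - j) ≤ γ := by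
    have : ((F.L : ℝ)⁻¹) ^ (K - j) ≤ 1 :=
      pow_le_one₀ (inv_nonneg.mpr hLpos.le) (inv_le_one_of_one_le₀ (by exact_mod_cast hL1))
    simpa using mul_le_mul_of_nonneg_left this hγ.le
  obtain ⟨g, hg_def⟩ : ∃ g : ℝ, g = Real.sqrt (γ * ((F.L : ℝ)⁻¹) ^ (K - j)) := ⟨_, rfl⟩
  have hg0 : 0 < g := by rw [hg_def]; exact Real.sqrt_pos.mpr hq0
  have hg_sq : g ^ 2 = γ * ((F.L : ℝ)⁻¹) ^ (K - j) := by rw [hg_def, Real.sq_sqrt hq0.le]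
  have hgg₁ : g ≤ g₁ := by
    have h1 : γ * ((F.L : ℝ)⁻¹) ^ (K - j) ≤ g₁ ^ 2 := hq1.trans (hγ1.trans (min_le_right _ _))
    rw [hg_def]
    exact (Real.sqrt_le_sqrt h1).trans_eq (Real.sqrt_sq hg₁.le)
  have hggs : g ≤ gs := hgg₁.trans (min_le_left _ _)
  have hgb : g ≤ b₀ / (16 * (C + 1)) := hgg₁.trans (min_le_right _ _)
  have hg1' : g ≤ 1 := hggs.trans hgs1
  -- thresholds: `θ(b₀) = g·p(g)`, `θ(b₀/4) = g·p(g)/4`, `p(g) ≥ b₀`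
  set P : ℝ := B10.pFun b₀ p₀ g with hP_def
  have hθ : θBal F.L γ b₀ p₀ (K - j) = g * P := by rw [hP_def, hg_def]; rfl
  have hθ4 : θBal F.L γ (b₀ / 4) p₀ (K - j) = g * P / 4 := by
    rw [show b₀ / 4 = (1 / 4 : ℝ) * b₀ by ring, T3InteriorExcision.θBal_mul, hθ]; ring
  have hPb : b₀ ≤ P := by
    rw [hP_def, pFun_eq]
    have hx1 := one_le_xlog hg0 hg1'
    have : (1 : ℝ) ≤ xlog g ^ p₀ := Real.one_le_rpow hx1 (by linarith)
    nlinarith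
  -- layer cake at `a = θ(b₀/4)`
  have hf0 : ∀ U : GaugeField (F.P K) 0 (Matrix.specialUnitaryGroup (Fin 2) ℂ), 0 ≤ GaugeGroup.dist1 (GaugeField.plaqHol
      (Averaging.iter (fun i => BlockAveraging.blockAvg (P := F.P K) (j := i) ℰp) j U) p) := fun U => GaugeGroup.dist1_nonneg _
  have hf2 : ∀ U : GaugeField (F.P K) 0 (Matrix.specialUnitaryGroup (Fin 2) ℂ), GaugeGroup.dist1 (GaugeField.plaqHol
      (Averaging.iter (fun i => BlockAveraging.blockAvg (P := F.P K) (j := i) ℰp) j U) p) ≤ 2 := fun U => dist1_le_two _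
  have ha : 0 ≤ θBal F.L γ (b₀ / 4) p₀ (K - j) := by
    rw [hθ4]; exact div_nonneg (mul_nonneg hg0.le (hb₀.le.trans hPb)) (by norm_num)
  have hlayer := integral_le_add_mul_measureReal_ge' (μ := gibbsK F ℰp γ K) ha zero_le_two hf0 hf2
  -- the tail at the profile `b₀/4` and the decay `C·g⁻¹⁰·e^{−c p(b₀/4)²} ≤ C·g²`
  have ht := htail F hFL γ hγ hγone (b₀ / 4) (by positivity) p₀ K j hjK hj0 p
  have hβ : (F.scheme ℰp γ).β (K - j) = (g ^ 2)⁻¹ := by rw [hg_sq]; rfl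
  rw [hβ, ← hg_def] at ht
  have hdec' := hdec g hg0 hggs
  have hmain : 2 * (C * (g ^ 2)⁻¹ ^ 5 * Real.exp (-(c * B10.pFun (b₀ / 4) p₀ g ^ 2))) ≤ g * P / 4 := by
    have h1 : C * (g ^ 2)⁻¹ ^ 5 * Real.exp (-(c * B10.pFun (b₀ / 4) p₀ g ^ 2)) ≤ C * (g ^ 2)⁻¹ ^ 5 * g ^ 12 :=
      mul_le_mul_of_nonneg_left hdec' (by positivity)
    have h2 : C * (g ^ 2)⁻¹ ^ 5 * g ^ 12 = C * g ^ 2 := by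
      field_simp
    have h4 : 16 * (C + 1) * g ≤ b₀ := by
      have := mul_le_mul_of_nonneg_left hgb (by positivity : (0 : ℝ) ≤ 16 * (C + 1))
      rwa [mul_div_cancel₀ _ (by positivity : (16 : ℝ) * (C + 1) ≠ 0)] at this
    have h3 : 2 * (C * g ^ 2) ≤ g * P / 4 := by nlinarith [hg0.le, hC, hPb]
    linarith [h1, h2.le, h2.ge]
  calc ∫ U, GaugeGroup.dist1 (GaugeField.plaqHol
          (Averaging.iter (fun i => BlockAveraging.blockAvg (P := F.P K) (j := i) ℰp) j U) p) ∂(gibbsK F ℰp γ K)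
      ≤ θBal F.L γ (b₀ / 4) p₀ (K - j) + 2 * (gibbsK F ℰp γ K).real {U | θBal F.L γ (b₀ / 4) p₀ (K - j) ≤
          GaugeGroup.dist1 (GaugeField.plaqHol
            (Averaging.iter (fun i => BlockAveraging.blockAvg (P := F.P K) (j := i) ℰp) j U) p)} := hlayer
    _ ≤ g * P / 4 + g * P / 4 := add_le_add hθ4.le ((mul_le_mul_of_nonneg_left ht zero_le_two).trans hmain)
    _ = θBal F.L γ b₀ p₀ (K - j) / 2 := by rw [hθ]; ring

end Mean

end Summit.QuantumFields.YangMills.Theorems.RevelationMartingaleMeanDeviationBoundedDepth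

end
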